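import Literature.NumberTheory.Weil1964.RealWeilIndex
import Mathlib.MeasureTheory.Integral.Pi
import Mathlib.MeasureTheory.Measure.Haar.InnerProductSpace
import Mathlib.MeasureTheory.Measure.Haar.NormedSpace
import Mathlib.Analysis.InnerProductSpace.PiL2
import HarnessLib

/-!
# Weil's index of a real quadratic form in several variables (`G = ℝⁿ`) and at the complex place

Topic `NumberTheory/Weil1964`; namespace `Literature.NumberTheory.Weil1964`. KERNEL mathematics only
(two definitions with bodies + theorems; no named fact, no `axiom`, no `sorry`). Sequel of
`RealWeilIndex.lean` (the one-variable index `realWeilIndex c = γ(e^{2πi c x²}) = e^{iπ sgn(c)/4}`),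
discharging its `TODO(general form)`.

Let `G = ℝ^ι` (`ι` finite), self-dual through `⟨x, y⟩ = e^{2πi x·y}` (Lebesgue measure is then
self-dual), and let `f` be the second-degree character of the DIAGONAL non-degenerate quadratic form
`q(x) = ∑ cᵢ xᵢ²` (`cᵢ ≠ 0`; by [Weil1964, Chap. II n° 26 p. 173] "toute forme quadratique non dégénérée
est équivalente à une forme `q_a(x) - q_b(y)`" — every real form is diagonal in suitable coordinates, and
`γ(f ∘ α) = γ(f)` for an isomorphism `α`, n° 25 p. 173): `f(x) = e^{2πi ∑ cᵢ xᵢ²} = ∏ᵢ e^{2πi cᵢ xᵢ²}`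
(`realChirpPi c`), associated with the symmetric morphism `ρ = 2 diag(c)`, `|ρ| = ∏ |2cᵢ|`.

* §1 `realChirpPi c x = ∏ᵢ realChirp (cᵢ) (xᵢ)`: second-degree law with the bicharacter
  `e^{2πi u·(ρ x)}`, conjugation, orthogonal sums (`Sum.elim`), re-indexing, temperate growth.
* §2 `realWeilIndexPi c = ∏ᵢ realWeilIndex (cᵢ)` — by [Weil1964, Chap. II n° 25 Prop. 3 p. 173]
  ("`γ(f) = γ(f₁) γ(f₂)`" for `f = f₁ ⊕ f₂`, "il est évident, d'après la définition de `γ` dans le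
  théorème 2") this product IS the index of the diagonal form, which §3–§4 prove; its value
  `e^{iπ (∑ sgn cᵢ)/4}`, i.e. n° 26's **inertia formula** "si `f` a le type d'inertie `(a, b)`,
  `γ(f) = γ(q₁)^{a-b}`" (`realWeilIndexPi_inertia`), eighth root of unity, `γ(-f) = conj γ(f)`,
  multiplicativity on orthogonal sums (`realWeilIndexPi_sum`), and the **complex place**
  (`realWeilIndexPi_complexPlace`): for `k = ℂ`, `χ(z) = χ₀(λz + λ̄z̄)`, `f = λ⁻¹ q₁`, one has
  `χ ∘ f = χ₀ ∘ f₀` with `f₀(z) = z² + z̄² = 2x² - 2y²` of inertia `(1, 1)` on the underlying `ℝ²`,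
  hence `γ = γ(q₁) γ(q₁)⁻¹ = 1` [Weil1964, Chap. II n° 26 p. 174].
* §3 THÉORÈME 2 for `G = ℝ^ι` ([Weil1964, Chap. I n° 14 p. 161]) in tested form on the Euclidean space
  `V = EuclideanSpace ℝ ι` with Mathlib's Fourier transform `𝓕 g(ξ) = ∫ e^{-2πi ⟪v, ξ⟫} g(v) dv`:
  for `g ∈ L¹(V)` with `𝓕 g ∈ L¹(V)`,
  `∫ f_d(ξ) 𝓕g(ξ) dξ = γ(d) ∏|2dᵢ|^{-1/2} ∫ e^{-2πi ∑ xᵢ²/(4dᵢ)} g(x) dx` (`integral_realChirpPi_mul_fourier`),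
  i.e. `𝓕(f) = γ(f) |ρ|^{-1/2} f̄(· ρ⁻¹)`; proved by the product-Gaussian regularisation
  `e^{-π ∑ (ε - 2idᵢ) ξᵢ²}` (Mathlib `fourier_gaussian_pi` coordinatewise after Fubini
  `integral_fintype_prod_volume_eq_prod`), self-adjointness of `𝓕` and dominated convergence `ε → 0⁺`.
* §4 COROLLAIRE 2 for `G = ℝ^ι` and every Schwartz `Φ` ([Weil1964, Chap. I n° 14 p. 162]):
  `∫∫ Φ(u) f(x - u) du dx = γ(f) |ρ|^{-1/2} ∫ Φ`, on `V` (`weil_corollary2_euclidean`) and transported to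
  the product space `ι → ℝ` with Lebesgue measure (`weil_corollary2_pi`, the currency of the tree's
  archimedean Schwartz spaces `𝓢((ι → ℝ), ℂ)`); uniqueness of the scalar (`realWeilIndexPi_unique`), so
  the definition by the product IS Weil's `γ(f)`.

Conventions as in `RealWeilIndex.lean`: Mathlib's `𝓕`, character `e^{2πi x}` (`λ = 1`); for the tree's
Tate character `ψ_ℝ(x) = e^{-2πix}` use `c ↦ -c` (`realWeilIndexPi_neg`). Not treated here: the index of
a form given by a non-diagonal symmetric matrix (reduce by an orthogonal diagonalisation, n° 25) —
TODO(general form): `γ` of `x ↦ e^{2πi xᵀ S x}` for a symmetric invertible `S` as `∏ γ(eigenvalues)`.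

## References

* [Weil1964] A. Weil, *Sur certains groupes d'opérateurs unitaires*, Acta Math. 111 (1964) 143–211:
  Chap. I n° 14 Théorème 2, Corollaires 1–2 (pp. 161–162); Chap. II n° 25 Prop. 3 (p. 173), n° 26
  (pp. 173–174: `k = R`, type d'inertie, `γ(f) = γ(q₁)^{a-b}`; `k = C`, `γ(f) = 1`).
-/

set_option autoImplicit false

noncomputable section

open MeasureTheory Complex Filter Topology Set Finset
open scoped Real FourierTransform SchwartzMap BigOperators ComplexConjugate

namespace Literature.NumberTheory.Weil1964

variable {ι : Type*} [Fintype ι]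

/-! ## §1 The second-degree character `x ↦ e^{2πi ∑ cᵢ xᵢ²}` of `ℝ^ι` -/

/-- The **second-degree character** `f(x) = e^{2πi ∑ᵢ cᵢ xᵢ²} = ∏ᵢ e^{2πi cᵢ xᵢ²}` of `G = ℝ^ι` attached to
the character `e^{2πi t}` and the diagonal quadratic form `q(x) = ∑ cᵢ xᵢ²` (non-degenerate iff all
`cᵢ ≠ 0`); the orthogonal sum of the one-variable characters `realChirp (cᵢ)`.
[cite: Weil1964, Chap. II n° 25–26, p. 173] -/
def realChirpPi (c : ι → ℝ) (x : ι → ℝ) : ℂ := ∏ i, realChirp (c i) (x i)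

/-- unfolding. [cite: Weil1964, Chap. II n° 25, p. 173] -/
theorem realChirpPi_apply (c x : ι → ℝ) : realChirpPi c x = ∏ i, realChirp (c i) (x i) := rfl

/-- `f(x) = e^{2πi ∑ cᵢ xᵢ²}`. [cite: Weil1964, Chap. II n° 26, p. 173] -/
theorem realChirpPi_eq_cexp_sum (c x : ι → ℝ) :
    realChirpPi c x = cexp (2 * π * I * ∑ i, (c i : ℂ) * (x i : ℂ) ^ 2) := by
  rw [realChirpPi, Finset.mul_sum, Complex.exp_sum]
  refine Finset.prod_congr rfl fun i _ => ?_
  rw [realChirp_apply]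
  congr 1
  ring

/-- `|f(x)| = 1`. [cite: Weil1964, Chap. I n° 2, p. 146] -/
theorem norm_realChirpPi (c x : ι → ℝ) : ‖realChirpPi c x‖ = 1 := by
  rw [realChirpPi, norm_prod]
  simp [norm_realChirp]

/-- `f(x) ≠ 0`. [cite: Weil1964, Chap. I n° 2, p. 146] -/
theorem realChirpPi_ne_zero (c x : ι → ℝ) : realChirpPi c x ≠ 0 := by
  rw [← norm_ne_zero_iff, norm_realChirpPi]
  exact one_ne_zero

/-- `f(0) = 1`. [cite: Weil1964, Chap. I n° 2, p. 146] -/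
@[simp] theorem realChirpPi_zero_right (c : ι → ℝ) : realChirpPi c 0 = 1 := by
  simp [realChirpPi]

/-- the degenerate form `c = 0` gives the trivial character. [cite: Weil1964, Chap. I n° 2, p. 146] -/
@[simp] theorem realChirpPi_zero_left (x : ι → ℝ) : realChirpPi (0 : ι → ℝ) x = 1 := by
  simp [realChirpPi]

/-- **the second-degree law** in the form used for convolutions:
`f(x - u) = f(x) f(u) e^{-2πi ∑ uᵢ (2 cᵢ xᵢ)}`; the last factor is the Fourier kernel at the
frequency `ρ x = (2 cᵢ xᵢ)ᵢ`. [cite: Weil1964, Chap. I n° 2, p. 146] -/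
theorem realChirpPi_sub (c x u : ι → ℝ) :
    realChirpPi c (x - u) =
      realChirpPi c x * realChirpPi c u * cexp (↑(-2 * π * ∑ i, u i * (2 * c i * x i)) * I) := by
  have h : cexp (↑(-2 * π * ∑ i, u i * (2 * c i * x i)) * I) =
      ∏ i, cexp (↑(-2 * π * u i * (2 * c i * x i)) * I) := by
    rw [← Complex.exp_sum]
    congr 1
    push_cast
    rw [Finset.mul_sum, Finset.sum_mul]
    exact Finset.sum_congr rfl fun i _ => by ring
  rw [realChirpPi, realChirpPi, realChirpPi, h, ← Finset.prod_mul_distrib, ← Finset.prod_mul_distrib]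
  exact Finset.prod_congr rfl fun i _ => by rw [Pi.sub_apply, realChirp_sub]

/-- `χ ∘ (-f)` is the complex conjugate of `χ ∘ f`. [cite: Weil1964, Chap. II n° 25, p. 173] -/
theorem realChirpPi_neg_left (c x : ι → ℝ) : realChirpPi (-c) x = conj (realChirpPi c x) := by
  rw [realChirpPi, realChirpPi, map_prod]
  exact Finset.prod_congr rfl fun i _ => by rw [Pi.neg_apply, realChirp_neg_left]

/-- `f(x) · (χ ∘ (-f))(x) = 1`. [cite: Weil1964, Chap. II n° 25, p. 173] -/
theorem realChirpPi_mul_realChirpPi_neg (c x : ι → ℝ) : realChirpPi c x * realChirpPi (-c) x = 1 := by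
  rw [realChirpPi, realChirpPi, ← Finset.prod_mul_distrib]
  exact Finset.prod_eq_one fun i _ => by rw [Pi.neg_apply, realChirp_mul_realChirp_neg]

/-- equivalent forms, diagonal dilations: `e^{2πi ∑ (cᵢ bᵢ²) xᵢ²} = f(b ⊙ x)`.
[cite: Weil1964, Chap. II n° 25, p. 173] -/
theorem realChirpPi_mul_sq (c b x : ι → ℝ) :
    realChirpPi (fun i => c i * b i ^ 2) x = realChirpPi c (fun i => b i * x i) := by
  rw [realChirpPi, realChirpPi]
  exact Finset.prod_congr rfl fun i _ => realChirp_mul_sq _ _ _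

/-- **orthogonal sums**: the character of `q₁ ⊕ q₂` on `ℝ^{ι₁} ⊕ ℝ^{ι₂}` is `f₁(x₁) f₂(x₂)`
(Weil's `f(x₁, x₂) = f₁(x₁) + f₂(x₂)` "sur la somme directe de `X₁` et de `X₂`").
[cite: Weil1964, Chap. II n° 25, p. 173] -/
theorem realChirpPi_sum {ι₁ ι₂ : Type*} [Fintype ι₁] [Fintype ι₂] (c₁ : ι₁ → ℝ) (c₂ : ι₂ → ℝ)
    (x : ι₁ ⊕ ι₂ → ℝ) :
    realChirpPi (Sum.elim c₁ c₂) x =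
      realChirpPi c₁ (fun i => x (Sum.inl i)) * realChirpPi c₂ (fun j => x (Sum.inr j)) := by
  rw [realChirpPi, Fintype.prod_sum_type]
  rfl

/-- re-indexing the coordinates does not change the character (equivalent forms).
[cite: Weil1964, Chap. II n° 25, p. 173] -/
theorem realChirpPi_comp_equiv {κ : Type*} [Fintype κ] (e : κ ≃ ι) (c x : ι → ℝ) :
    realChirpPi (c ∘ e) (x ∘ e) = realChirpPi c x := by
  rw [realChirpPi, realChirpPi]
  exact e.prod_comp (fun i => realChirp (c i) (x i))

/-- `f` is continuous. [cite: Weil1964, Chap. I n° 2, p. 146] -/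
@[fun_prop]
theorem continuous_realChirpPi (c : ι → ℝ) : Continuous (realChirpPi c) := by
  unfold realChirpPi
  fun_prop

/-! ## §2 The Weil index of a diagonal real form: definition as the product, values -/

/-- **Weil's index `γ(f)` of the second-degree character `f = e^{2πi ∑ cᵢ xᵢ²}` of `ℝ^ι`**, DEFINED as
the product `∏ᵢ γ(e^{2πi cᵢ xᵢ²}) = ∏ᵢ e^{iπ sgn(cᵢ)/4}` of the one-variable indices — Weil's Prop. 3
("`γ(f) = γ(f₁) γ(f₂)`" for an orthogonal sum, "il est évident d'après la définition de `γ` dans le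
théorème 2"); §3–§4 PROVE that this scalar is the one of Théorème 2 / Corollaire 2 for `G = ℝ^ι`, which
determines it (`realWeilIndexPi_unique`).
[cite: Weil1964, Chap. I n° 14 Thm 2 p. 161; Chap. II n° 25 Prop. 3 p. 173, n° 26 p. 174] -/
def realWeilIndexPi (c : ι → ℝ) : ℂ := ∏ i, realWeilIndex (c i)

/-- unfolding. [cite: Weil1964, Chap. II n° 25 Prop. 3, p. 173] -/
theorem realWeilIndexPi_apply (c : ι → ℝ) : realWeilIndexPi c = ∏ i, realWeilIndex (c i) := rfl

/-- the value `γ(f) = e^{iπ (∑ᵢ sgn cᵢ)/4}`. [cite: Weil1964, Chap. II n° 26, p. 174] -/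
theorem realWeilIndexPi_eq_cexp (c : ι → ℝ) :
    realWeilIndexPi c = cexp (((π / 4 * ∑ i, (SignType.sign (c i) : ℝ) : ℝ) : ℂ) * I) := by
  rw [realWeilIndexPi, show ((π / 4 * ∑ i, (SignType.sign (c i) : ℝ) : ℝ) : ℂ) * I =
      ∑ i, (((π / 4 * (SignType.sign (c i) : ℝ) : ℝ) : ℂ) * I) by
        push_cast; rw [Finset.mul_sum, Finset.sum_mul], Complex.exp_sum]
  rfl

/-- `|γ(f)| = 1`. [cite: Weil1964, Chap. I n° 14 Thm 2, p. 161] -/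
theorem norm_realWeilIndexPi (c : ι → ℝ) : ‖realWeilIndexPi c‖ = 1 := by
  rw [realWeilIndexPi, norm_prod]
  simp [norm_realWeilIndex]

/-- `γ(f) ≠ 0`. [cite: Weil1964, Chap. I n° 14 Thm 2, p. 161] -/
theorem realWeilIndexPi_ne_zero (c : ι → ℝ) : realWeilIndexPi c ≠ 0 :=
  Finset.prod_ne_zero_iff.2 fun i _ => realWeilIndex_ne_zero (c i)

/-- the empty form (`n = 0`, the zero element of the Witt group) has index `1` (`γ` is a character of the
Witt group). [cite: Weil1964, Chap. II n° 25 Prop. 3, p. 173] -/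
@[simp] theorem realWeilIndexPi_of_isEmpty [IsEmpty ι] (c : ι → ℝ) : realWeilIndexPi c = 1 := by
  simp [realWeilIndexPi]

/-- **`γ(f)` is an eighth root of unity** (a product of eighth roots of unity).
[cite: Weil1964, Chap. II n° 26, p. 174] -/
theorem realWeilIndexPi_pow_eight (c : ι → ℝ) : realWeilIndexPi c ^ 8 = 1 := by
  rw [realWeilIndexPi, ← Finset.prod_pow]
  exact Finset.prod_eq_one fun i _ => realWeilIndex_pow_eight (c i)

/-- **`γ(-f) = conj γ(f) = γ(f)⁻¹`**. [cite: Weil1964, Chap. II n° 25, p. 173] -/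
theorem realWeilIndexPi_neg (c : ι → ℝ) : realWeilIndexPi (-c) = conj (realWeilIndexPi c) := by
  rw [realWeilIndexPi, realWeilIndexPi, map_prod]
  exact Finset.prod_congr rfl fun i _ => by rw [Pi.neg_apply, realWeilIndex_neg]

/-- `γ(-f) = γ(f)⁻¹`. [cite: Weil1964, Chap. II n° 25, p. 173] -/
theorem realWeilIndexPi_neg_eq_inv (c : ι → ℝ) : realWeilIndexPi (-c) = (realWeilIndexPi c)⁻¹ := by
  rw [realWeilIndexPi_neg]
  exact (Complex.inv_eq_conj (norm_realWeilIndexPi c)).symm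

/-- `γ(f) γ(-f) = 1`. [cite: Weil1964, Chap. II n° 25, p. 173] -/
theorem realWeilIndexPi_mul_realWeilIndexPi_neg (c : ι → ℝ) :
    realWeilIndexPi c * realWeilIndexPi (-c) = 1 := by
  rw [realWeilIndexPi_neg_eq_inv, mul_inv_cancel₀ (realWeilIndexPi_ne_zero c)]

/-- **Weil's Proposition 3 (multiplicativity on orthogonal sums)**: `γ(f₁ ⊕ f₂) = γ(f₁) γ(f₂)`.
[cite: Weil1964, Chap. II n° 25 Prop. 3, p. 173] -/
theorem realWeilIndexPi_sum {ι₁ ι₂ : Type*} [Fintype ι₁] [Fintype ι₂] (c₁ : ι₁ → ℝ) (c₂ : ι₂ → ℝ) :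
    realWeilIndexPi (Sum.elim c₁ c₂) = realWeilIndexPi c₁ * realWeilIndexPi c₂ := by
  rw [realWeilIndexPi, Fintype.prod_sum_type]
  rfl

/-- the one-variable case: `γ` of `e^{2πi c x²}` on `ℝ¹`. [cite: Weil1964, Chap. II n° 26, p. 174] -/
theorem realWeilIndexPi_unique_index {κ : Type*} [Unique κ] (c : κ → ℝ) :
    realWeilIndexPi c = realWeilIndex (c default) := by
  rw [realWeilIndexPi, Fintype.prod_unique]

/-- **equivalent forms have the same index**: re-indexing. [cite: Weil1964, Chap. II n° 25, p. 173] -/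
theorem realWeilIndexPi_comp_equiv {κ : Type*} [Fintype κ] (e : κ ≃ ι) (c : ι → ℝ) :
    realWeilIndexPi (c ∘ e) = realWeilIndexPi c := by
  rw [realWeilIndexPi, realWeilIndexPi]
  exact e.prod_comp (fun i => realWeilIndex (c i))

/-- **equivalent forms have the same index**: diagonal dilations `cᵢ ↦ cᵢ rᵢ`, `rᵢ > 0`.
[cite: Weil1964, Chap. II n° 25, p. 173] -/
theorem realWeilIndexPi_mul_of_pos {c r : ι → ℝ} (hr : ∀ i, 0 < r i) :
    realWeilIndexPi (fun i => c i * r i) = realWeilIndexPi c := by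
  rw [realWeilIndexPi, realWeilIndexPi]
  exact Finset.prod_congr rfl fun i _ => realWeilIndex_mul_of_pos (hr i)

/-- equivalent forms: `γ(∑ cᵢ bᵢ² xᵢ²) = γ(∑ cᵢ xᵢ²)` for `bᵢ ≠ 0`. [cite: Weil1964, Chap. II n° 25, p. 173] -/
theorem realWeilIndexPi_mul_sq {c b : ι → ℝ} (hb : ∀ i, b i ≠ 0) :
    realWeilIndexPi (fun i => c i * b i ^ 2) = realWeilIndexPi c :=
  realWeilIndexPi_mul_of_pos fun i => by have := hb i; positivity

/-- `γ` for `c` and for the Fourier-side parameter `(1/(4cᵢ))ᵢ` (`ρ⁻¹`-transformed form) coincide.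
[cite: Weil1964, Chap. I n° 14 Thm 2, p. 161] -/
theorem realWeilIndexPi_one_div_four_mul (c : ι → ℝ) :
    realWeilIndexPi (fun i => 1 / (4 * c i)) = realWeilIndexPi c := by
  rw [realWeilIndexPi, realWeilIndexPi]
  exact Finset.prod_congr rfl fun i _ => realWeilIndex_one_div_four_mul (c i)

/-- **the inertia formula**: if the non-degenerate diagonal form has `a` positive and `b` negative
coefficients (type d'inertie `(a, b)`), then `γ(f) = γ(q₁)^a · (γ(q₁)⁻¹)^b = γ(q₁)^{a-b}`
("la proposition 3 montre que, si `f` a le type d'inertie `(a, b)`, `γ(f) = γ(q₁)^{a-b}`").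
[cite: Weil1964, Chap. II n° 26, p. 173] -/
theorem realWeilIndexPi_inertia [DecidableEq ι] {c : ι → ℝ} (hc : ∀ i, c i ≠ 0) :
    realWeilIndexPi c =
      realWeilIndex 1 ^ (Finset.univ.filter fun i => 0 < c i).card *
        (realWeilIndex 1)⁻¹ ^ (Finset.univ.filter fun i => c i < 0).card := by
  classical
  rw [realWeilIndexPi, ← Finset.prod_filter_mul_prod_filter_not Finset.univ (fun i => 0 < c i)]
  congr 1
  · rw [← Finset.prod_const]
    refine Finset.prod_congr rfl fun i hi => ?_
    rw [Finset.mem_filter] at hi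
    rw [show c i = 1 * c i by ring, realWeilIndex_mul_of_pos hi.2]
  · have hset : (Finset.univ.filter fun i => ¬0 < c i) = Finset.univ.filter fun i => c i < 0 := by
      ext i
      simp only [Finset.mem_filter, Finset.mem_univ, true_and, not_lt]
      exact ⟨fun h => lt_of_le_of_ne h (hc i), le_of_lt⟩
    rw [hset, ← Finset.prod_const]
    refine Finset.prod_congr rfl fun i hi => ?_
    rw [Finset.mem_filter] at hi
    rw [show c i = -1 * (-c i) by ring, realWeilIndex_mul_of_pos (neg_pos.2 hi.2),
      realWeilIndex_neg_eq_inv]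

/-- the index of a POSITIVE definite diagonal form in `n` variables is `γ(q₁)^n = e^{iπ n/4}`.
[cite: Weil1964, Chap. II n° 26, p. 174] -/
theorem realWeilIndexPi_of_pos {c : ι → ℝ} (hc : ∀ i, 0 < c i) :
    realWeilIndexPi c = cexp (π / 4 * I) ^ Fintype.card ι := by
  rw [realWeilIndexPi, ← realWeilIndex_one, ← Finset.card_univ, ← Finset.prod_const]
  exact Finset.prod_congr rfl fun i _ => by
    rw [show c i = 1 * c i by ring, realWeilIndex_mul_of_pos (hc i)]

/-- **the complex place**: for `k = C` Weil writes the character as `χ(z) = χ₀(λz + λ̄z̄)` and, for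
`f = λ⁻¹ q₁`, `χ ∘ f = χ₀ ∘ f₀` with `f₀(z) = z² + z̄² = 2x² - 2y²` "une forme quadratique de type
d'inertie `(1, 1)`" on the real plane underlying `C`; hence `γ(f) = γ(q₁) γ(q₁)⁻¹ = 1`, "Il en est donc de
même pour toute forme quadratique non dégénérée sur `C`". In the coordinates `(x, y)`: the index of the
diagonal form `(2c, -2c)` (any real `c ≠ 0`, absorbing `λ`) is `1`. [cite: Weil1964, Chap. II n° 26, p. 174] -/
theorem realWeilIndexPi_complexPlace (c : ℝ) : realWeilIndexPi ![2 * c, -(2 * c)] = 1 := by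
  simp [realWeilIndexPi, Fin.prod_univ_two, realWeilIndex_mul_realWeilIndex_neg]

/-- more generally a diagonal form with as many positive as negative coefficients (inertia `(a, a)`,
e.g. any `ℂ`-quadratic form viewed over `ℝ`) has index `1`. [cite: Weil1964, Chap. II n° 26, p. 174] -/
theorem realWeilIndexPi_eq_one_of_card_eq [DecidableEq ι] {c : ι → ℝ} (hc : ∀ i, c i ≠ 0)
    (h : (Finset.univ.filter fun i => 0 < c i).card = (Finset.univ.filter fun i => c i < 0).card) :
    realWeilIndexPi c = 1 := by
  rw [realWeilIndexPi_inertia hc, h, ← mul_pow, mul_inv_cancel₀ (realWeilIndex_ne_zero 1), one_pow]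

/-! ## §3 Théorème 2 for `G = ℝ^ι`: the Fourier transform of `f` as a tempered distribution

As in the one-variable file: for `ε > 0` the regularised character `∏ᵢ e^{-π bᵢ ξᵢ²}`,
`bᵢ = ε - 2idᵢ`, is an integrable product Gaussian on `V = EuclideanSpace ℝ ι` whose Fourier transform
is the product of the one-variable transforms (Fubini + Mathlib's `fourier_gaussian_pi`), and `ε → 0⁺`
is dominated convergence on both sides of `∫ 𝓕(G_ε) g = ∫ G_ε 𝓕g`. The elementary facts about
`b = ε - 2id` are re-proved here (they are private to `RealWeilIndex.lean`). -/

/-- the Gaussian parameter `b_ε = ε - 2id` of the regularised character `e^{-πεξ²} e^{2πi d ξ²}`. [folklore] -/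
private def bR (a ε : ℝ) : ℂ := (ε : ℂ) - 2 * a * I

/-- `Re b_ε = ε`. [folklore] -/
private theorem bR_re (a ε : ℝ) : (bR a ε).re = ε := by
  simp [bR]

/-- `Im b_ε = -2d`. [folklore] -/
private theorem bR_im (a ε : ℝ) : (bR a ε).im = -(2 * a) := by
  simp [bR]

/-- `b_0 = -2id`. [folklore] -/
private theorem bR_zero (a : ℝ) : bR a 0 = -2 * a * I := by
  simp [bR]

/-- `ε ↦ b_ε` is continuous. [folklore] -/
private theorem continuous_bR (a : ℝ) : Continuous (bR a) := by
  unfold bR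
  fun_prop

/-- `b_ε ≠ 0` (`d ≠ 0`). [folklore] -/
private theorem bR_ne_zero {a : ℝ} (ha : a ≠ 0) (ε : ℝ) : bR a ε ≠ 0 := by
  intro h
  have := congr_arg Complex.im h
  rw [bR_im, Complex.zero_im, neg_eq_zero] at this
  exact ha (by linarith)

/-- `|2d| ≤ |b_ε|`. [folklore] -/
private theorem abs_le_norm_bR (a ε : ℝ) : |2 * a| ≤ ‖bR a ε‖ := by
  have h := Complex.abs_im_le_norm (bR a ε)
  rwa [bR_im, abs_neg] at h

/-- the regularised characters have modulus `≤ 1` (`ε ≥ 0`). [folklore] -/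
private theorem norm_cexp_bR_le (a : ℝ) {ε : ℝ} (hε : 0 ≤ ε) (ξ : ℝ) :
    ‖cexp (-π * bR a ε * (ξ : ℂ) ^ 2)‖ ≤ 1 := by
  rw [Complex.norm_exp, Real.exp_le_one_iff,
    show -π * bR a ε * (ξ : ℂ) ^ 2 = ((-(π * ξ ^ 2) : ℝ) : ℂ) * bR a ε by push_cast; ring,
    Complex.re_ofReal_mul, bR_re]
  have : 0 ≤ π * ξ ^ 2 * ε := by positivity
  linarith

/-- the Fourier-side kernels `e^{-π x²/b_ε}` have modulus `≤ 1` (`ε ≥ 0`). [folklore] -/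
private theorem norm_cexp_div_bR_le (a : ℝ) {ε : ℝ} (hε : 0 ≤ ε) (x : ℝ) :
    ‖cexp (-π / bR a ε * (x : ℂ) ^ 2)‖ ≤ 1 := by
  rw [Complex.norm_exp, Real.exp_le_one_iff,
    show -π / bR a ε * (x : ℂ) ^ 2 = ((-(π * x ^ 2) : ℝ) : ℂ) * (bR a ε)⁻¹ by
      rw [div_eq_mul_inv]; push_cast; ring,
    Complex.re_ofReal_mul, Complex.inv_re, bR_re]
  have h1 : 0 ≤ ε / Complex.normSq (bR a ε) := div_nonneg hε (Complex.normSq_nonneg _)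
  have : 0 ≤ π * x ^ 2 * (ε / Complex.normSq (bR a ε)) := by positivity
  linarith

/-- `|b_ε^{-1/2}| ≤ |2d|^{-1/2}`. [folklore] -/
private theorem norm_one_div_cpow_bR_le {a : ℝ} (ha : a ≠ 0) (ε : ℝ) :
    ‖1 / bR a ε ^ (1 / 2 : ℂ)‖ ≤ |2 * a| ^ (-(1 / 2 : ℝ)) := by
  have hpos : 0 < |2 * a| := abs_pos.2 (mul_ne_zero two_ne_zero ha)
  rw [norm_div, norm_one, show (1 / 2 : ℂ) = ((1 / 2 : ℝ) : ℂ) by push_cast; ring,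
    Complex.norm_cpow_real, Real.rpow_neg hpos.le, ← one_div]
  exact one_div_le_one_div_of_le (Real.rpow_pos_of_pos hpos _)
    (Real.rpow_le_rpow hpos.le (abs_le_norm_bR a ε) (by norm_num))

/-- `(-2id)^{1/2} = √|2d| · e^{-iπ sgn(d)/4}` (principal branch; n° 26's "calcul élémentaire"). [folklore] -/
private theorem cpow_half_neg_two_mul_I' {a : ℝ} (ha : a ≠ 0) :
    (-2 * (a : ℂ) * I) ^ (1 / 2 : ℂ) =
      (Real.sqrt |2 * a| : ℂ) * cexp (((-(π / 4 * (SignType.sign a : ℝ)) : ℝ) : ℂ) * I) := by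
  set θ : ℝ := -(π / 4 * (SignType.sign a : ℝ)) with hθ
  set w : ℂ := (Real.sqrt |2 * a| : ℂ) * cexp ((θ : ℂ) * I) with hw
  have h2a : 0 < |2 * a| := abs_pos.2 (mul_ne_zero two_ne_zero ha)
  have hr : 0 < Real.sqrt |2 * a| := Real.sqrt_pos.2 h2a
  have hθval : θ = π / 4 ∨ θ = -(π / 4) := by
    rcases lt_or_gt_of_ne ha with h | h
    · left; rw [hθ, sign_neg h, SignType.coe_neg_one]; ring
    · right; rw [hθ, sign_pos h, SignType.coe_one]; ring
  have hθmem : θ ∈ Set.Ioc (-π) π := by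
    rcases hθval with h | h <;> (rw [h]; constructor <;> linarith [Real.pi_pos])
  have harg : arg w = θ := by
    rw [hw, Complex.exp_mul_I]
    exact arg_mul_cos_add_sin_mul_I hr hθmem
  have hw2 : w ^ 2 = -2 * (a : ℂ) * I := by
    rw [hw, mul_pow, ← Complex.exp_nat_mul, ← Complex.ofReal_pow, Real.sq_sqrt h2a.le,
      show ((2 : ℕ) : ℂ) * ((θ : ℂ) * I) = ((2 * θ : ℝ) : ℂ) * I by push_cast; ring, Complex.exp_mul_I,
      ← Complex.ofReal_cos, ← Complex.ofReal_sin]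
    rcases lt_or_gt_of_ne ha with h | h
    · rw [hθ, sign_neg h, SignType.coe_neg_one, abs_of_neg (by linarith : 2 * a < 0),
        show 2 * -(π / 4 * (-1 : ℝ)) = π / 2 by ring, Real.cos_pi_div_two, Real.sin_pi_div_two]
      push_cast
      ring
    · rw [hθ, sign_pos h, SignType.coe_one, abs_of_pos (by linarith : 0 < 2 * a),
        show 2 * -(π / 4 * (1 : ℝ)) = -(π / 2) by ring, Real.cos_neg, Real.sin_neg, Real.cos_pi_div_two,
        Real.sin_pi_div_two]
      push_cast
      ring
  rw [← hw2, show (1 / 2 : ℂ) = (2 : ℂ)⁻¹ by norm_num]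
  refine pow_cpow_ofNat_inv ?_ ?_
  · rw [harg]; rcases hθval with h | h <;> (rw [h]; linarith [Real.pi_pos])
  · rw [harg]; rcases hθval with h | h <;> (rw [h]; linarith [Real.pi_pos])

/-- the limiting Fourier-side constant: `1 / (-2id)^{1/2} = γ · |2d|^{-1/2}`. [cite: Weil1964, Chap. II n° 26, p. 174] -/
private theorem one_div_cpow_bR_zero {a : ℝ} (ha : a ≠ 0) :
    1 / bR a 0 ^ (1 / 2 : ℂ) = realWeilIndex a * ((|2 * a| ^ (-(1 / 2 : ℝ)) : ℝ) : ℂ) := by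
  have h2a : 0 < |2 * a| := abs_pos.2 (mul_ne_zero two_ne_zero ha)
  rw [bR_zero, cpow_half_neg_two_mul_I' ha, realWeilIndex, Real.rpow_neg h2a.le, ← Real.sqrt_eq_rpow,
    one_div, mul_inv, ← Complex.exp_neg, mul_comm]
  congr 1
  · congr 1; push_cast; ring
  · push_cast; rfl

/-- the limiting Fourier-side kernel: `e^{-π x²/(-2id)} = e^{-2πi x²/(4d)}`. [cite: Weil1964, Chap. I n° 14 Thm 2, p. 161] -/
private theorem cexp_div_bR_zero {a : ℝ} (ha : a ≠ 0) (x : ℝ) :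
    cexp (-π / bR a 0 * (x : ℂ) ^ 2) = realChirp (-(1 / (4 * a))) x := by
  rw [bR_zero, realChirp]
  congr 1
  have hne : (-2 * (a : ℂ) * I) ≠ 0 := by rw [← bR_zero]; exact bR_ne_zero ha 0
  have ha' : (a : ℂ) ≠ 0 := Complex.ofReal_ne_zero.2 ha
  rw [div_mul_eq_mul_div, div_eq_iff hne]
  push_cast
  field_simp
  ring_nf
  rw [Complex.I_sq]
  ring

/-- the one-variable Fourier transform of the Gaussian `e^{-π b t²}` (`Re b > 0`) as an explicit integral:
`∫ e^{-2πi t w} e^{-π b t²} dt = b^{-1/2} e^{-π w²/b}` (Mathlib's `fourier_gaussian_pi`). [folklore] -/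
private theorem integral_fourierKernel_mul_gaussian {b : ℂ} (hb : 0 < b.re) (w : ℝ) :
    ∫ t : ℝ, cexp (↑(-2 * π * t * w) * I) * cexp (-π * b * (t : ℂ) ^ 2) =
      1 / b ^ (1 / 2 : ℂ) * cexp (-π / b * (w : ℂ) ^ 2) := by
  have h := congr_fun (fourier_gaussian_pi hb) w
  rw [Real.fourier_real_eq_integral_exp_smul] at h
  simpa only [smul_eq_mul] using h

omit [Fintype ι] in
/-- the coordinates of `EuclideanSpace ℝ ι` are continuous. [folklore] -/
private theorem continuous_coord (i : ι) : Continuous fun v : EuclideanSpace ℝ ι => v i :=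
  PiLp.continuous_apply 2 _ i

/-- **Weil's Théorème 2 for `G = ℝ^ι`** (the Fourier transform of the second-degree character
`f = e^{2πi ∑ dᵢ ξᵢ²}` of a non-degenerate diagonal form, as a tempered distribution on the Euclidean space
`V = ℝ^ι` with Mathlib's `𝓕 g(ξ) = ∫ e^{-2πi⟪v, ξ⟫} g(v) dv`): for every `g ∈ L¹(V)` with `𝓕 g ∈ L¹(V)`,
`∫ f(ξ) 𝓕g(ξ) dξ = γ(f) ∏ᵢ|2dᵢ|^{-1/2} ∫ e^{-2πi ∑ xᵢ²/(4dᵢ)} g(x) dx`, i.e. `𝓕(f) = γ(f) |ρ|^{-1/2} f̄(· ρ⁻¹)`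
with `ρ = 2 diag(d)`, `|ρ| = ∏ |2dᵢ|`, `γ(f) = realWeilIndexPi d = ∏ γ(e^{2πi dᵢ x²})`.
[cite: Weil1964, Chap. I n° 14 Thm 2, p. 161; Chap. II n° 25 Prop. 3 p. 173, n° 26 p. 174] -/
theorem integral_realChirpPi_mul_fourier {d : ι → ℝ} (hd : ∀ i, d i ≠ 0)
    {g : EuclideanSpace ℝ ι → ℂ} (hg : Integrable g) (hFg : Integrable (𝓕 g)) :
    ∫ ξ : EuclideanSpace ℝ ι, realChirpPi d ξ * 𝓕 g ξ =
      realWeilIndexPi d * ((∏ i, |2 * d i| ^ (-(1 / 2 : ℝ)) : ℝ) : ℂ) *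
        ∫ x : EuclideanSpace ℝ ι, realChirpPi (fun i => -(1 / (4 * d i))) x * g x := by
  -- regularised character `G ε` and Fourier-side kernel `K ε`
  set G : ℝ → EuclideanSpace ℝ ι → ℂ := fun ε ξ => ∏ i, cexp (-π * bR (d i) ε * ((ξ i : ℝ) : ℂ) ^ 2)
    with hG
  set K : ℝ → EuclideanSpace ℝ ι → ℂ :=
    fun ε x => ∏ i, (1 / bR (d i) ε ^ (1 / 2 : ℂ) * cexp (-π / bR (d i) ε * ((x i : ℝ) : ℂ) ^ 2)) with hK
  have hGcont : ∀ ε, Continuous (G ε) := fun ε => by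
    rw [hG]
    exact continuous_finsetProd _ fun i _ =>
      Complex.continuous_exp.comp (continuous_const.mul ((Complex.continuous_ofReal.comp
        (continuous_coord i)).pow 2))
  have hKcont : ∀ ε, Continuous (K ε) := fun ε => by
    rw [hK]
    exact continuous_finsetProd _ fun i _ => continuous_const.mul
      (Complex.continuous_exp.comp (continuous_const.mul ((Complex.continuous_ofReal.comp
        (continuous_coord i)).pow 2)))
  -- (A0) the Fourier transform of the product Gaussian is the product of the one-variable transforms
  have hA0 : ∀ ε : ℝ, 0 < ε → 𝓕 (G ε) = K ε := by
    intro ε hε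
    funext w
    rw [Real.fourier_eq', ← (PiLp.volume_preserving_toLp ι).integral_comp
      (MeasurableEquiv.toLp 2 (ι → ℝ)).measurableEmbedding]
    simp only [smul_eq_mul]
    have hsplit : ∀ x : ι → ℝ,
        cexp (↑(-2 * π * inner ℝ (WithLp.toLp 2 x) w) * I) * G ε (WithLp.toLp 2 x) =
          ∏ i, (cexp (↑(-2 * π * x i * w i) * I) * cexp (-π * bR (d i) ε * ((x i : ℝ) : ℂ) ^ 2)) := by
      intro x
      rw [Finset.prod_mul_distrib, hG]
      simp only [PiLp.inner_apply, RCLike.inner_apply, conj_trivial]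
      congr 1
      rw [← Complex.exp_sum]
      congr 1
      push_cast
      rw [Finset.mul_sum, Finset.sum_mul]
      exact Finset.sum_congr rfl fun i _ => by ring
    simp_rw [hsplit]
    rw [integral_fintype_prod_volume_eq_prod
      (f := fun i (t : ℝ) => cexp (↑(-2 * π * t * w i) * I) * cexp (-π * bR (d i) ε * ((t : ℝ) : ℂ) ^ 2))]
    rw [hK]
    exact Finset.prod_congr rfl fun i _ =>
      integral_fourierKernel_mul_gaussian (by rw [bR_re]; exact hε) (w i)
  -- (A) the identity for the regularised characters, `ε > 0`
  have hA : ∀ ε : ℝ, 0 < ε → ∫ ξ : EuclideanSpace ℝ ι, G ε ξ * 𝓕 g ξ =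
      ∫ x : EuclideanSpace ℝ ι, K ε x * g x := by
    intro ε hε
    have hint : Integrable (G ε) := by
      rw [← (PiLp.volume_preserving_toLp ι).integrable_comp_emb
        (MeasurableEquiv.toLp 2 (ι → ℝ)).measurableEmbedding]
      have h1 : ∀ i, Integrable (fun t : ℝ => cexp (-π * bR (d i) ε * (t : ℂ) ^ 2)) := fun i => by
        have h := integrable_cexp_neg_mul_sq (b := π * bR (d i) ε)
          (by rw [Complex.re_ofReal_mul, bR_re]; exact mul_pos Real.pi_pos hε)
        simpa only [neg_mul] using h
      have h2 : Integrable (fun x : ι → ℝ => ∏ i, cexp (-π * bR (d i) ε * ((x i : ℝ) : ℂ) ^ 2))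
          (Measure.pi fun _ : ι => (volume : Measure ℝ)) :=
        Integrable.fintype_prod (f := fun i (t : ℝ) => cexp (-π * bR (d i) ε * (t : ℂ) ^ 2)) h1
      convert h2 using 1
      · funext x
        simp [hG]
      · rfl
    have key : ∫ ξ : EuclideanSpace ℝ ι, 𝓕 (G ε) ξ * g ξ = ∫ x : EuclideanSpace ℝ ι, G ε x * 𝓕 g x := by
      simpa using! VectorFourier.integral_fourierIntegral_smul_eq_flip (L := innerₗ (EuclideanSpace ℝ ι))
        Real.continuous_fourierChar continuous_inner hint hg
    rw [← key, hA0 ε hε]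
  -- (B1) `ε → 0⁺` on the character side
  have hB1 : Tendsto (fun ε => ∫ ξ : EuclideanSpace ℝ ι, G ε ξ * 𝓕 g ξ) (𝓝[>] 0)
      (𝓝 (∫ ξ : EuclideanSpace ℝ ι, realChirpPi d ξ * 𝓕 g ξ)) := by
    refine tendsto_integral_filter_of_dominated_convergence (fun ξ => ‖𝓕 g ξ‖) ?_ ?_ hFg.norm ?_
    · exact Eventually.of_forall fun ε => (hGcont ε).aestronglyMeasurable.mul hFg.aestronglyMeasurable
    · filter_upwards [self_mem_nhdsWithin] with ε (hε : 0 < ε)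
      refine Eventually.of_forall fun ξ => ?_
      rw [norm_mul]
      refine mul_le_of_le_one_left (norm_nonneg _) ?_
      rw [hG, norm_prod]
      exact Finset.prod_le_one (fun i _ => norm_nonneg _) fun i _ => norm_cexp_bR_le (d i) hε.le _
    · refine Eventually.of_forall fun ξ => ?_
      have hc : Continuous fun ε : ℝ => G ε ξ * 𝓕 g ξ := by
        rw [hG]
        refine Continuous.mul (continuous_finsetProd _ fun i _ => ?_) continuous_const
        have := continuous_bR (d i)
        fun_prop
      have h0 : G 0 ξ * 𝓕 g ξ = realChirpPi d ξ * 𝓕 g ξ := by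
        rw [hG, realChirpPi]
        congr 1
        refine Finset.prod_congr rfl fun i _ => ?_
        rw [bR_zero, realChirp]
        congr 1
        ring
      rw [← h0]
      exact tendsto_nhdsWithin_of_tendsto_nhds (hc.tendsto 0)
  -- (B2) `ε → 0⁺` on the Fourier side
  have hB2 : Tendsto (fun ε => ∫ x : EuclideanSpace ℝ ι, K ε x * g x) (𝓝[>] 0)
      (𝓝 (∫ x : EuclideanSpace ℝ ι, K 0 x * g x)) := by
    refine tendsto_integral_filter_of_dominated_convergence
      (fun x => (∏ i, |2 * d i| ^ (-(1 / 2 : ℝ))) * ‖g x‖) ?_ ?_ (hg.norm.const_mul _) ?_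
    · exact Eventually.of_forall fun ε => (hKcont ε).aestronglyMeasurable.mul hg.aestronglyMeasurable
    · filter_upwards [self_mem_nhdsWithin] with ε (hε : 0 < ε)
      refine Eventually.of_forall fun x => ?_
      rw [norm_mul, hK, norm_prod]
      gcongr with i hi
      rw [norm_mul]
      calc ‖1 / bR (d i) ε ^ (1 / 2 : ℂ)‖ * ‖cexp (-π / bR (d i) ε * ((x i : ℝ) : ℂ) ^ 2)‖
          ≤ |2 * d i| ^ (-(1 / 2 : ℝ)) * 1 := by
            gcongr
            · exact norm_one_div_cpow_bR_le (hd i) ε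
            · exact norm_cexp_div_bR_le (d i) hε.le _
        _ = |2 * d i| ^ (-(1 / 2 : ℝ)) := mul_one _
    · refine Eventually.of_forall fun x => tendsto_nhdsWithin_of_tendsto_nhds ?_
      have hKx : Tendsto (fun ε => K ε x) (𝓝 0) (𝓝 (K 0 x)) := by
        rw [hK]
        refine tendsto_finsetProd _ fun i _ => ?_
        have hslit : bR (d i) 0 ∈ slitPlane := by
          rw [mem_slitPlane_iff, bR_im]
          right
          intro h
          exact hd i (by linarith)
        have h1 : ContinuousAt (fun ε : ℝ => bR (d i) ε ^ (1 / 2 : ℂ)) 0 :=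
          ContinuousAt.comp (g := fun z : ℂ => z ^ (1 / 2 : ℂ)) (continuousAt_cpow_const hslit)
            (continuous_bR (d i)).continuousAt
        have h2 : ContinuousAt (fun ε : ℝ => 1 / bR (d i) ε ^ (1 / 2 : ℂ)) 0 :=
          continuousAt_const.div h1 (by
            rw [Ne, Complex.cpow_eq_zero_iff, not_and_or]
            exact Or.inl (bR_ne_zero (hd i) 0))
        have h3 : Continuous fun ε : ℝ => cexp (-π / bR (d i) ε * ((x i : ℝ) : ℂ) ^ 2) :=
          Complex.continuous_exp.comp
            ((continuous_const.div (continuous_bR (d i)) (bR_ne_zero (hd i))).mul continuous_const)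
        exact (h2.mul h3.continuousAt).tendsto
      exact hKx.mul tendsto_const_nhds
  -- (C) the two sides agree for `ε > 0`, hence in the limit
  have hAC : (fun ε => ∫ ξ : EuclideanSpace ℝ ι, G ε ξ * 𝓕 g ξ) =ᶠ[𝓝[>] 0]
      fun ε => ∫ x : EuclideanSpace ℝ ι, K ε x * g x := by
    filter_upwards [self_mem_nhdsWithin] with ε hε using hA ε hε
  have hlim : ∫ ξ : EuclideanSpace ℝ ι, realChirpPi d ξ * 𝓕 g ξ =
      ∫ x : EuclideanSpace ℝ ι, K 0 x * g x :=
    tendsto_nhds_unique (hB1.congr' hAC) hB2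
  -- (D) evaluate the limit kernel: `K 0 x = γ(d) ∏|2dᵢ|^{-1/2} f̄(x ρ⁻¹)`
  have hK0 : ∀ x : EuclideanSpace ℝ ι, K 0 x = realWeilIndexPi d *
      ((∏ i, |2 * d i| ^ (-(1 / 2 : ℝ)) : ℝ) : ℂ) * realChirpPi (fun i => -(1 / (4 * d i))) x := by
    intro x
    rw [hK, realWeilIndexPi, realChirpPi, Complex.ofReal_prod, ← Finset.prod_mul_distrib,
      ← Finset.prod_mul_distrib]
    exact Finset.prod_congr rfl fun i _ => by
      rw [one_div_cpow_bR_zero (hd i), cexp_div_bR_zero (hd i)]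
  rw [hlim, ← integral_const_mul]
  congr 1
  funext x
  rw [hK0 x, mul_assoc]

/-- Théorème 2 for `G = ℝ^ι`, Schwartz test functions. [cite: Weil1964, Chap. I n° 14 Thm 2, p. 161] -/
theorem integral_realChirpPi_mul_fourier_schwartz {d : ι → ℝ} (hd : ∀ i, d i ≠ 0)
    (g : 𝓢(EuclideanSpace ℝ ι, ℂ)) :
    ∫ ξ : EuclideanSpace ℝ ι, realChirpPi d ξ * 𝓕 (⇑g) ξ =
      realWeilIndexPi d * ((∏ i, |2 * d i| ^ (-(1 / 2 : ℝ)) : ℝ) : ℂ) *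
        ∫ x : EuclideanSpace ℝ ι, realChirpPi (fun i => -(1 / (4 * d i))) x * g x :=
  integral_realChirpPi_mul_fourier hd g.integrable (by
    rw [← SchwartzMap.fourier_coe]
    exact (𝓕 g).integrable)

/-! ## §4 Corollaire 2 for `G = ℝ^ι`: `∫ (Φ ∗ f) = γ(f) |ρ|^{-1/2} ∫ Φ` -/

/-- integrals over the Euclidean space `V = ℝ^ι` are integrals over the product space `ι → ℝ`
(the identification `toLp` preserves Lebesgue measure). [folklore] -/
private theorem integral_euclidean_eq_pi {E : Type*} [NormedAddCommGroup E] [NormedSpace ℝ E]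
    (F : EuclideanSpace ℝ ι → E) : ∫ v, F v = ∫ x : ι → ℝ, F (WithLp.toLp 2 x) :=
  ((PiLp.volume_preserving_toLp ι).integral_comp (MeasurableEquiv.toLp 2 (ι → ℝ)).measurableEmbedding
    F).symm

/-- **diagonal change of variables** in `ℝ^ι`: `∫ F(a ⊙ x) dx = (∏ |aᵢ|)⁻¹ ∫ F` for `aᵢ ≠ 0`
(the module of the automorphism `x ↦ a ⊙ x` of `ℝ^ι`). [folklore] -/
private theorem integral_comp_diag_pi {E : Type*} [NormedAddCommGroup E] [NormedSpace ℝ E]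
    {a : ι → ℝ} (ha : ∀ i, a i ≠ 0) (F : (ι → ℝ) → E) :
    ∫ x : ι → ℝ, F (fun i => a i * x i) = (∏ i, |a i|)⁻¹ • ∫ y : ι → ℝ, F y := by
  classical
  set A : (ι → ℝ) →ₗ[ℝ] (ι → ℝ) := Matrix.toLin' (Matrix.diagonal a) with hA
  have hAx : ∀ x, A x = fun i => a i * x i := fun x => by
    funext i
    rw [hA, Matrix.toLin'_apply, Matrix.mulVec_diagonal]
  have hdet : LinearMap.det A = ∏ i, a i := by rw [hA, LinearMap.det_toLin', Matrix.det_diagonal]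
  have hne : LinearMap.det A ≠ 0 := by rw [hdet]; exact Finset.prod_ne_zero_iff.2 fun i _ => ha i
  set e : (ι → ℝ) ≃ₗ[ℝ] (ι → ℝ) := LinearMap.equivOfDetNeZero A hne with he
  set em : (ι → ℝ) ≃ᵐ (ι → ℝ) := e.toContinuousLinearEquiv.toHomeomorph.toMeasurableEquiv with hem
  have hcoe : ∀ x, em x = A x := fun x => rfl
  have hcoe' : (em : (ι → ℝ) → (ι → ℝ)) = A := funext hcoe
  calc ∫ x : ι → ℝ, F (fun i => a i * x i) = ∫ x : ι → ℝ, F (em x) := by simp_rw [hcoe, hAx]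
    _ = ∫ y, F y ∂(Measure.map em volume) := (integral_map_equiv em F).symm
    _ = ∫ y, F y ∂(ENNReal.ofReal |(LinearMap.det A)⁻¹| • (volume : Measure (ι → ℝ))) := by
        rw [hcoe', Real.map_linearMap_volume_pi_eq_smul_volume_pi hne]
    _ = (∏ i, |a i|)⁻¹ • ∫ y : ι → ℝ, F y := by
        rw [integral_smul_measure, ENNReal.toReal_ofReal (abs_nonneg _), hdet, abs_inv, Finset.abs_prod]

/-- the coordinates `v ↦ vᵢ` of `EuclideanSpace ℝ ι` have temperate growth. [folklore] -/
private theorem hasTemperateGrowth_coord (i : ι) :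
    (fun v : EuclideanSpace ℝ ι => v i).HasTemperateGrowth :=
  (PiLp.proj 2 (fun _ : ι => ℝ) i).hasTemperateGrowth

/-- **`f = e^{2πi ∑ cᵢ vᵢ²}` has temperate growth** on `V = ℝ^ι`, so that `Φ ↦ f · Φ` preserves `𝓢(V)`
(Weil's `t(f)` on `𝒮(G)`, [Weil1964, Chap. I n° 12 Prop. 2]). [cite: Weil1964, Chap. I n° 12, p. 158] -/
theorem hasTemperateGrowth_realChirpPi_euclidean (c : ι → ℝ) :
    (fun v : EuclideanSpace ℝ ι => realChirpPi c v).HasTemperateGrowth := by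
  have hq : (fun v : EuclideanSpace ℝ ι => ∑ i, 2 * π * c i * (v i) ^ 2).HasTemperateGrowth :=
    Function.HasTemperateGrowth.sum fun i _ =>
      (Function.HasTemperateGrowth.const (2 * π * c i)).mul ((hasTemperateGrowth_coord i).pow 2)
  have h := Literature.Analysis.Fourier.hasTemperateGrowth_exp_I_mul.comp hq
  convert h using 1
  funext v
  simp only [Function.comp_apply, realChirpPi_eq_cexp_sum]
  congr 1
  push_cast
  rw [Finset.mul_sum, Finset.mul_sum]
  exact Finset.sum_congr rfl fun i _ => by ring

/-- Mathlib's Fourier transform on `EuclideanSpace ℝ ι` in coordinates: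
`𝓕 F(w) = ∫ e^{-2πi ∑ uᵢ wᵢ} F(u) du`. [folklore] -/
private theorem fourier_euclidean_apply (F : EuclideanSpace ℝ ι → ℂ) (w : EuclideanSpace ℝ ι) :
    𝓕 F w = ∫ u : EuclideanSpace ℝ ι, cexp (↑(-2 * π * ∑ i, u i * w i) * I) * F u := by
  rw [Real.fourier_eq']
  congr 1
  funext u
  simp only [PiLp.inner_apply, RCLike.inner_apply, conj_trivial, smul_eq_mul]
  rw [Finset.sum_congr rfl fun i _ => mul_comm (w i) (u i)]

/-- the convolution with a second-degree character is a modulated Fourier transform: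
`(Φ ∗ f)(x) = ∫ Φ(u) f(x - u) du = f(x) · 𝓕(f Φ)(ρ x)`, `ρ x = (2 cᵢ xᵢ)ᵢ`. [cite: Weil1964, Chap. I n° 14, p. 161] -/
theorem integral_mul_realChirpPi_sub (c : ι → ℝ) (Φ : EuclideanSpace ℝ ι → ℂ) (x : EuclideanSpace ℝ ι) :
    ∫ u : EuclideanSpace ℝ ι, Φ u * realChirpPi c ⇑(x - u) =
      realChirpPi c x * 𝓕 (fun u : EuclideanSpace ℝ ι => realChirpPi c u * Φ u)
        (WithLp.toLp 2 fun i => 2 * c i * x i) := by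
  rw [fourier_euclidean_apply, ← integral_const_mul]
  congr 1
  funext u
  rw [WithLp.ofLp_sub, realChirpPi_sub]
  dsimp only
  ring

/-- **Weil's Corollaire 2 for `G = ℝ^ι`** on the Euclidean space: for every Schwartz function `Φ` and the
non-degenerate diagonal second-degree character `f = e^{2πi ∑ cᵢ xᵢ²}` (`ρ = 2 diag(c)`),
`∫ (Φ ∗ f)(x) dx = γ(f) |ρ|^{-1/2} ∫ Φ(x) dx` with `γ(f) = ∏ γ(e^{2πi cᵢ x²})` and `|ρ| = ∏ |2cᵢ|`.
[cite: Weil1964, Chap. I n° 14 Cor. 2, p. 162; Chap. II n° 25 Prop. 3, p. 173] -/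
theorem weil_corollary2_euclidean {c : ι → ℝ} (hc : ∀ i, c i ≠ 0) (Φ : 𝓢(EuclideanSpace ℝ ι, ℂ)) :
    ∫ x : EuclideanSpace ℝ ι, ∫ u : EuclideanSpace ℝ ι, Φ u * realChirpPi c ⇑(x - u) =
      realWeilIndexPi c * ((∏ i, |2 * c i| ^ (-(1 / 2 : ℝ)) : ℝ) : ℂ) *
        ∫ x : EuclideanSpace ℝ ι, Φ x := by
  -- `h = f · Φ ∈ 𝓢(V)`
  set h : 𝓢(EuclideanSpace ℝ ι, ℂ) :=
    SchwartzMap.smulLeftCLM ℂ (fun v : EuclideanSpace ℝ ι => realChirpPi c v) Φ with hh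
  have h_apply : ∀ u, h u = realChirpPi c u * Φ u := fun u => by
    rw [hh, SchwartzMap.smulLeftCLM_apply_apply (hasTemperateGrowth_realChirpPi_euclidean c), smul_eq_mul]
  have h_coe : (fun u : EuclideanSpace ℝ ι => realChirpPi c u * Φ u) = ⇑h :=
    funext fun u => (h_apply u).symm
  -- the Fourier-side parameter `c'ᵢ = 1/(4cᵢ)`
  set c' : ι → ℝ := fun i => 1 / (4 * c i) with hc'
  have hc'ne : ∀ i, c' i ≠ 0 := fun i => one_div_ne_zero (mul_ne_zero four_ne_zero (hc i))
  have h2c : ∀ i, 2 * c i ≠ 0 := fun i => mul_ne_zero two_ne_zero (hc i)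
  have hcx : ∀ x : ι → ℝ, realChirpPi c x = realChirpPi c' (fun i => 2 * c i * x i) := fun x => by
    rw [← realChirpPi_mul_sq]
    congr 1
    funext i
    rw [hc']
    field_simp
    ring
  -- the inner integrals are `f(x) 𝓕h(ρ x)`; move to `ι → ℝ` and substitute `y = ρ x`
  simp_rw [integral_mul_realChirpPi_sub, h_coe]
  rw [integral_euclidean_eq_pi]
  dsimp only
  simp_rw [hcx]
  have step : ∫ x : ι → ℝ, realChirpPi c' (fun i => 2 * c i * x i) *
      𝓕 (⇑h) (WithLp.toLp 2 fun i => 2 * c i * x i) =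
        (∏ i, |2 * c i|)⁻¹ • ∫ y : ι → ℝ, realChirpPi c' y * 𝓕 (⇑h) (WithLp.toLp 2 y) :=
    integral_comp_diag_pi h2c (fun y => realChirpPi c' y * 𝓕 (⇑h) (WithLp.toLp 2 y))
  rw [step]
  have back : ∫ y : ι → ℝ, realChirpPi c' y * 𝓕 (⇑h) (WithLp.toLp 2 y) =
      ∫ v : EuclideanSpace ℝ ι, realChirpPi c' v * 𝓕 (⇑h) v := by
    rw [integral_euclidean_eq_pi]
  rw [back, integral_realChirpPi_mul_fourier_schwartz hc'ne h]
  -- back to `Φ`: `f_{-c} · (f_c Φ) = Φ`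
  have hback : ∀ v : EuclideanSpace ℝ ι, realChirpPi (fun i => -(1 / (4 * c' i))) v * h v = Φ v := fun v => by
    rw [h_apply, ← mul_assoc, show (fun i => -(1 / (4 * c' i))) = -c by
      funext i; rw [Pi.neg_apply, hc']; field_simp, mul_comm (realChirpPi (-c) _),
      realChirpPi_mul_realChirpPi_neg, one_mul]
  simp_rw [hback]
  rw [show realWeilIndexPi c' = realWeilIndexPi c from realWeilIndexPi_one_div_four_mul c,
    Complex.real_smul, ← mul_assoc, ← mul_assoc]
  congr 1
  -- constants: `(∏|2cᵢ|)⁻¹ · γ · ∏|2c'ᵢ|^{-1/2} = γ · ∏|2cᵢ|^{-1/2}`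
  rw [mul_comm ((((∏ i, |2 * c i|)⁻¹ : ℝ) : ℂ)), mul_assoc]
  congr 1
  rw [← Complex.ofReal_mul, ← Finset.prod_inv_distrib, ← Finset.prod_mul_distrib]
  congr 1
  refine Finset.prod_congr rfl fun i _ => ?_
  have h2ci : 0 < |2 * c i| := abs_pos.2 (h2c i)
  rw [hc', show 2 * (1 / (4 * c i)) = (2 * c i)⁻¹ by field_simp; ring, abs_inv, Real.inv_rpow h2ci.le,
    Real.rpow_neg h2ci.le, inv_inv, ← Real.rpow_neg h2ci.le, ← Real.rpow_neg_one, ← Real.rpow_add h2ci]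
  norm_num

/-- **Weil's Corollaire 2 for `G = ℝ^ι`** on the product space `ι → ℝ` with Lebesgue measure (the tree's
currency for archimedean Schwartz spaces): for every `Φ ∈ 𝓢(ℝ^ι)` and all `cᵢ ≠ 0`,
`∫∫ Φ(u) e^{2πi ∑ cᵢ (xᵢ - uᵢ)²} du dx = (∏ᵢ γ(e^{2πi cᵢ x²})) (∏ᵢ |2cᵢ|)^{-1/2} ∫ Φ`.
[cite: Weil1964, Chap. I n° 14 Cor. 2, p. 162; Chap. II n° 25 Prop. 3, p. 173] -/
theorem weil_corollary2_pi {c : ι → ℝ} (hc : ∀ i, c i ≠ 0) (Φ : 𝓢((ι → ℝ), ℂ)) :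
    ∫ x : ι → ℝ, ∫ u : ι → ℝ, Φ u * realChirpPi c (x - u) =
      realWeilIndexPi c * ((∏ i, |2 * c i| ^ (-(1 / 2 : ℝ)) : ℝ) : ℂ) * ∫ x : ι → ℝ, Φ x := by
  set Ψ : 𝓢(EuclideanSpace ℝ ι, ℂ) :=
    SchwartzMap.compCLMOfContinuousLinearEquiv ℂ (PiLp.continuousLinearEquiv 2 ℝ (fun _ : ι => ℝ)) Φ
    with hΨ
  have hΨ_apply : ∀ v : EuclideanSpace ℝ ι, Ψ v = Φ (WithLp.ofLp v) := fun v => rfl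
  have key := weil_corollary2_euclidean hc Ψ
  simp_rw [integral_euclidean_eq_pi, hΨ_apply, ← WithLp.toLp_sub] at key
  simpa using key

/-- **uniqueness of Weil's scalar**: if `γ ∈ ℂ` satisfies Corollaire 2 for `f = e^{2πi ∑ cᵢ xᵢ²}` and ONE
Schwartz function `Φ` with `∫ Φ ≠ 0`, then `γ = realWeilIndexPi c`; so the definition as the product of
the one-variable indices IS Weil's `γ(f)` for the diagonal form (Prop. 3).
[cite: Weil1964, Chap. I n° 14 Thm 2 and Cor. 2, pp. 161–162; Chap. II n° 25 Prop. 3, p. 173] -/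
theorem realWeilIndexPi_unique {c : ι → ℝ} (hc : ∀ i, c i ≠ 0) {γ : ℂ} (Φ : 𝓢((ι → ℝ), ℂ))
    (hΦ : ∫ x, Φ x ≠ 0)
    (h : ∫ x : ι → ℝ, ∫ u : ι → ℝ, Φ u * realChirpPi c (x - u) =
      γ * ((∏ i, |2 * c i| ^ (-(1 / 2 : ℝ)) : ℝ) : ℂ) * ∫ x, Φ x) :
    γ = realWeilIndexPi c := by
  rw [weil_corollary2_pi hc Φ] at h
  have hne : ((∏ i, |2 * c i| ^ (-(1 / 2 : ℝ)) : ℝ) : ℂ) ≠ 0 := by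
    exact_mod_cast (Finset.prod_pos fun i _ =>
      Real.rpow_pos_of_pos (abs_pos.2 (mul_ne_zero two_ne_zero (hc i))) _).ne'
  exact (mul_right_cancel₀ hne (mul_right_cancel₀ hΦ h)).symm

/-- the index for the TREE's standard real character `ψ_ℝ(x) = e^{-2πix}` (Tate's sign): the second-degree
character of `∑ aᵢ xᵢ²` is `realChirpPi (-a)` and its index is `conj (realWeilIndexPi a) = e^{-iπ(∑ sgn aᵢ)/4}`.
[cite: Weil1964, Chap. II n° 26, p. 174] -/
theorem realWeilIndexPi_tate (a : ι → ℝ) :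
    realWeilIndexPi (fun i => -1 * a i) = conj (realWeilIndexPi a) := by
  rw [show (fun i => -1 * a i) = -a by funext i; simp, realWeilIndexPi_neg]

end Literature.NumberTheory.Weil1964
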